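import Summits.BirchSwinnertonDyer.BirchSwinnertonDyer.Theses.CompanionSqueezeDoorRankTwo
import Summits.BirchSwinnertonDyer.BirchSwinnertonDyer.Theorems.SelmerRankShaCorank
import Literature.NumberTheory.EllipticCurves.BSDRankZeroDensityProofs
import Literature.NumberTheory.EllipticCurves.AnalyticRankModularityProofs
import Literature.NumberTheory.EllipticCurves.AnalyticRankOrderProofs
import Literature.NumberTheory.EllipticCurves.ComplexMultiplicationBurungaleFlachProofs
import Literature.NumberTheory.EllipticCurves.TamagawaFiniteIndexProofs
import HarnessLib

/-!
# BirchSwinnertonDyer / CompanionSqueezeDoorRankTwo — the SQUEEZE KERNEL (support item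
# stmt-BirchSwinnertonDyer-23777 `CompanionSqueezeKernel`)

Route `route-BirchSwinnertonDyer-CompanionSqueezeDoorRankTwo` (D-0145 ideator line bsd-idea-4 #4; director-bsd
W-62: T-tier DOOR target «T-r2C»/«T-r2Sha»; tribunal r1 PASSED 2026-08-28T00:24Z, J: "kernel 23777 … may be staffed
now"; staffing = bsd-rank2 eng capacity).  The item: from the print pack `PublishedInputsCompanion` — (i) Wuthrich
2014 Prop. 21 (`L(E,1) ≠ 0`, `Ш` finite ⇒ `C·(L(E,1)/Ω)·#tors²/Tam = m·#Ш`, `C` a unit away from `2`, additive and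
non-surjective primes), (ii) Gross–Zagier–Kolyvagin (`r_an ≤ 1 ⇒ rank = r_an ∧ Ш` finite), (iii) modularity — for
`p ≥ 5` and a SQUEEZE PAIR `(W₁, W₂)` of globally minimal elliptic curves over `ℚ` (`#Sel_p(W₁) = #Sel_p(W₂)`,
`rank W₁ ≥ 2`, `L(W₂,1) ≠ 0`, `W₂` good at `p` with surjective `ρ̄_{W₂,p}` and no rational `p`-torsion,
`v_p(L(W₂,1)/Ω · #tors² / Tam) ≤ 2`): `rank W₁ = 2`, `Ш(W₁)[p] = 0`, `corank_p Ш(W₁) = 0`, `corank Sel_{p^∞}(W₁) = 2`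
and `r_an(W₁) ≥ 2`.

PROOF (the planner's plan L): (`W₂` side, `CompanionSqueeze.natCard_selmerGroup_le_sq_of_L_one_ne_zero`) modularity
⇒ `L` entire ⇒ `r_an(W₂) = 0` (`analyticRank_eq_zero_iff_holds`) ⇒ GZK: `rank W₂ = 0`, `Ш(W₂)` finite ⇒ Wuthrich with
`v_p(C) = 0` (`p ≠ 2`, good, surjective) and `q, #tors, Tam, C ≠ 0` (`realPeriodRat_pos_holds`,
`torsionOrder_pos_holds`, `tamagawaProduct_pos_holds`) ⇒ `v_p(#Ш(W₂)) ≤ v_p(m) + v_p(#Ш(W₂)) = v_p(q·#tors²/Tam) ≤ 2`;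
the EXACT DESCENT COUNT `#Sel_p = p^{rank}·#E(ℚ)[p]·#Ш[p]` (`WeierstrassCurve.natCard_selmerGroup_eq`, Silverman
X.4.2) with `rank = 0`, `E(ℚ)[p] = 0` gives `#Sel_p(W₂) = #Ш(W₂)[p] ≤ p^{v_p(#Ш(W₂))} ≤ p²` (`Ш[p]` is a `p`-group
inside `Ш`).  (`W₁` side, `CompanionSqueeze.squeeze`) the same count for `W₁` reads `p^{rank}·p^{t}·p^{s} ≤ p²` with
`rank ≥ 2`, so `rank = 2` and `s = 0`: `Ш(W₁)[p] = 0`, hence `Ш(W₁)[p^∞] = 0`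
(`primaryComponent_eq_bot_of_forall_smul_eq_zero`), `corank_p Ш(W₁) = 0` (`Literature.BSD.shaCorank_eq_zero_of_finite`),
`corank Sel_{p^∞}(W₁) = rank + corank = 2` (`selmerCorank_eq_mordellWeilRank_add_holds`), and `r_an(W₁) ≤ 1` would
force `rank ≤ 1` by GZK.

This is a DOOR kernel: nothing here proves a class theorem at rank `≥ 2`; the supply crux (24274) and the leaf are
NOT proved; BSD is NOT proved by it.  PARTITION: none — r_an ≥ 2, summit axis S0; TWIN (D-0056): n/a. B1 honesty:
Kummer/descent-count bookkeeping over three published inputs taken as the item's own antecedent.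
-/

set_option linter.dupNamespace false
set_option autoImplicit false

noncomputable section

open scoped Classical AddSubgroup

namespace Summit.BirchSwinnertonDyer.BirchSwinnertonDyer.Theorems

open WeierstrassCurve Literature.NumberTheory.EllipticCurves
  Summit.BirchSwinnertonDyer.BirchSwinnertonDyer.Theses.CompanionSqueezeDoorRankTwo

namespace CompanionSqueeze

/-- In an additive commutative group without elements of order `p`, the `p`-primary component is
trivial: an element of order `p^(n+1)` would give the element `p^n • a` of order `p`. [folklore] -/
theorem primaryComponent_eq_bot_of_forall_smul_eq_zero {A : Type*} [AddCommGroup A] (p : ℕ)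
    [hp : Fact p.Prime] (h : ∀ a : A, (p : ℤ) • a = 0 → a = 0) :
    AddCommGroup.primaryComponent A p = ⊥ := by
  refine (AddSubgroup.eq_bot_iff_forall _).mpr fun a ha ↦ ?_
  obtain ⟨n, hn⟩ := (AddCommGroup.mem_primaryComponent_iff_addOrderOf (p := p)).mp ha
  induction n generalizing a with
  | zero => exact AddMonoid.addOrderOf_eq_one_iff.mp (by rw [hn, pow_zero])
  | succ k ih =>
    -- `b := p^k • a` is killed by `p`, hence zero; so `addOrderOf a ∣ p^k`, contradiction
    have hb : (p : ℤ) • ((p ^ k : ℕ) • a) = 0 := by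
      rw [natCast_zsmul, ← mul_nsmul', ← pow_succ', ← hn]
      exact addOrderOf_nsmul_eq_zero a
    have hb0 := h _ hb
    have hdvd : addOrderOf a ∣ p ^ k := addOrderOf_dvd_of_nsmul_eq_zero hb0
    rw [hn] at hdvd
    exact absurd (Nat.le_of_dvd (pow_pos hp.out.pos k) hdvd)
      (not_le.mpr (Nat.pow_lt_pow_right hp.out.one_lt (Nat.lt_succ_self k)))

/-- `#Ш(E)[p] ≤ p^{v_p(#Ш(E))}` for a finite Tate–Shafarevich group: `Ш[p]` is a `p`-group inside
`Ш`. [folklore] -/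
theorem natCard_sha_torsionBy_le_pow (W : WeierstrassCurve ℚ) [W.IsElliptic] (p : ℕ) [hp : Fact p.Prime]
    (hfin : Finite W.sha) :
    Nat.card (W.sha ⊓ AddSubgroup.torsionBy W.galH1 (p : ℤ) : AddSubgroup W.galH1) ≤
      p ^ padicValNat p W.shaOrder := by
  haveI : Finite ((W.sha)[(p : ℤ)]) := W.finite_sha_torsionBy_holds (p : ℤ)
    (Int.natCast_ne_zero.mpr hp.out.ne_zero)
  rw [← Literature.Algebra.Module.natCard_torsionBy_addSubgroup W.sha (p : ℤ)]
  obtain ⟨a, ha⟩ := exists_natCard_eq_pow_of_nsmul_eq_zero (G := (W.sha)[(p : ℤ)]) p fun x ↦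
    AddSubgroup.torsionBy.nsmul x
  rw [ha]
  refine Nat.pow_le_pow_right hp.out.pos ?_
  have hdvd : p ^ a ∣ W.shaOrder := by
    rw [← ha]
    exact AddSubgroup.card_addSubgroup_dvd_card _
  exact (padicValNat_dvd_iff_le (W.shaOrder_pos hfin).ne').mp hdvd


/-- **The rank-`0` side: `#Sel_p(W₂) ≤ p²`.**  For `W₂/ℚ` globally minimal with `L(W₂,1) ≠ 0`, good at
`p ≥ 5` with surjective mod-`p` representation, no rational `p`-torsion and
`v_p(L(W₂,1)/Ω · #tors² / Tam) ≤ 2`: modularity gives `r_an(W₂) = 0`, Gross–Zagier–Kolyvagin gives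
`rank W₂ = 0` and `Ш(W₂)` finite, Wuthrich's Prop. 21 (with `C` a `p`-adic unit: `p ≠ 2`, good,
surjective) gives `v_p(#Ш(W₂)) ≤ 2`, and the exact descent count gives
`#Sel_p(W₂) = p⁰ · #W₂(ℚ)[p] · #Ш(W₂)[p] = #Ш(W₂)[p] ≤ p^{v_p(#Ш)} ≤ p²`.
[cite: Wuthrich2014, Prop. 21 (p. 400)] [cite: Darmon2004, Thm. 3.22] [cite: SilvermanAEC2009, Thm X.4.2] -/
theorem natCard_selmerGroup_le_sq_of_L_one_ne_zero
    (hWu : Wuthrich2014_shaOrder_dvd_of_L_one_ne_zero)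
    (hGZK : rank_eq_analyticRank_of_analyticRank_le_one)
    (hmod : ModularForms.existsUnique_isNewformOf)
    (W₂ : WeierstrassCurve ℚ) [W₂.IsElliptic] [W₂.IsGloballyMinimal] (p : ℕ) [hp : Fact p.Prime]
    (h5 : 5 ≤ p) (hL : W₂.entireLFunction 1 ≠ 0) (hgood : W₂.HasGoodReductionAtPrime p)
    (hsurj : W₂.HasSurjectiveModNGaloisRep p) (hnotors : ∀ P : W₂.toAffine.Point, (p : ℤ) • P = 0 → P = 0)
    {q : ℚ} (hq : W₂.entireLFunction 1 / (W₂.realPeriodRat : ℂ) = (q : ℂ))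
    (hv : padicValRat p (q * (W₂.torsionOrder : ℚ) ^ 2 / (W₂.tamagawaProduct : ℚ)) ≤ 2) :
    Nat.card (W₂.selmerGroup (p : ℤ)) ≤ p ^ 2 := by
  have hp0 : p ≠ 0 := hp.out.ne_zero
  -- r_an = 0, rank = 0, Ш finite
  have hEnt : W₂.HasEntireLFunction := hasEntireLFunction_rat_of_modularity hmod W₂
  have hr0 : W₂.analyticRank = 0 := (W₂.analyticRank_eq_zero_iff_holds hEnt).mpr hL
  obtain ⟨hrank, hfin⟩ := hGZK W₂ (by rw [hr0]; exact zero_le_one)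
  rw [hr0] at hrank
  -- Wuthrich Prop. 21
  obtain ⟨q', C, hq', hC0, hCp, m, hm⟩ := hWu W₂ hL hfin
  have hqq : q' = q := by exact_mod_cast hq'.symm.trans hq
  subst hqq
  have hvC : padicValRat p C = 0 := by
    by_contra hne
    rcases hCp p hne with h2 | ⟨hng, -⟩ | ⟨hns, -⟩
    · omega
    · exact hng hgood
    · exact hns hsurj
  -- positivity of the factors
  have hΩ : W₂.realPeriodRat ≠ 0 := (show (0 : ℝ) < W₂.realPeriodRat from W₂.realPeriodRat_pos_holds).ne'
  have hq0 : q' ≠ 0 := by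
    rintro rfl
    rw [Rat.cast_zero, div_eq_zero_iff] at hq'
    rcases hq' with h | h
    · exact hL h
    · exact hΩ (by exact_mod_cast h)
  have ht0 : (W₂.torsionOrder : ℚ) ≠ 0 := by exact_mod_cast (W₂.torsionOrder_pos_holds).ne'
  have hT0 : (W₂.tamagawaProduct : ℚ) ≠ 0 := by
    exact_mod_cast (show 0 < W₂.tamagawaProduct from W₂.tamagawaProduct_pos_holds).ne'
  have hS0 : W₂.shaOrder ≠ 0 := (W₂.shaOrder_pos hfin).ne'
  have hx0 : q' * (W₂.torsionOrder : ℚ) ^ 2 / (W₂.tamagawaProduct : ℚ) ≠ 0 := by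
    refine div_ne_zero (mul_ne_zero hq0 (pow_ne_zero 2 ht0)) hT0
  have hlhs : C * q' * (W₂.torsionOrder : ℚ) ^ 2 / (W₂.tamagawaProduct : ℚ) =
      C * (q' * (W₂.torsionOrder : ℚ) ^ 2 / (W₂.tamagawaProduct : ℚ)) := by ring
  have hm0 : (m : ℚ) ≠ 0 := by
    intro h0
    rw [h0, zero_mul, hlhs] at hm
    exact mul_ne_zero hC0 hx0 hm
  -- valuations: `v_p(#Ш) ≤ v_p(m) + v_p(#Ш) = v_p(C) + v_p(q t²/T) ≤ 2`
  have hval : (padicValNat p W₂.shaOrder : ℤ) ≤ 2 := by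
    have h1 : padicValRat p (C * q' * (W₂.torsionOrder : ℚ) ^ 2 / (W₂.tamagawaProduct : ℚ)) ≤ 2 := by
      rw [hlhs, padicValRat.mul hC0 hx0, hvC, zero_add]
      exact hv
    rw [hm, padicValRat.mul hm0 (by exact_mod_cast hS0), padicValRat.of_nat] at h1
    have h2 : 0 ≤ padicValRat p (m : ℚ) := by
      rw [padicValRat.of_int]
      exact_mod_cast Nat.zero_le _
    linarith
  have hval' : padicValNat p W₂.shaOrder ≤ 2 := by exact_mod_cast hval
  -- the descent count for `W₂`
  have hSel := W₂.natCard_selmerGroup_eq hp0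
  have htors : W₂.toAffine.Point[(p : ℤ)] = ⊥ := by
    refine (AddSubgroup.eq_bot_iff_forall _).mpr fun P hP ↦ hnotors P ?_
    rw [natCast_zsmul]
    exact AddSubgroup.torsionBy.nsmul_iff.mp hP
  have hcard1 : Nat.card (W₂.toAffine.Point[(p : ℤ)]) = 1 := AddSubgroup.card_eq_one.mpr htors
  -- the descent count is stated with the classical `DecidableEq ℚ` instance on `E(ℚ)`; align the instances
  have hinst : (fun a b ↦ Classical.propDecidable (a = b) : DecidableEq ℚ) = instDecidableEqRat :=
    Subsingleton.elim _ _
  rw [hinst] at hSel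
  rw [hrank, pow_zero, one_mul, hcard1, one_mul] at hSel
  rw [hSel]
  exact (CompanionSqueeze.natCard_sha_torsionBy_le_pow W₂ p hfin).trans
    (Nat.pow_le_pow_right hp.out.pos hval')

/-- **The SQUEEZE KERNEL with the three published inputs as separate hypotheses.**  For `p ≥ 5` and a
squeeze pair `(W₁, W₂)` of globally minimal elliptic curves over `ℚ` — `#Sel_p(W₁) = #Sel_p(W₂)`,
`rank W₁ ≥ 2`, and `W₂` as in `natCard_selmerGroup_le_sq_of_L_one_ne_zero` — the exact descent count
`#Sel_p(W₁) = p^{rank} · #W₁(ℚ)[p] · #Ш(W₁)[p] ≤ p²` forces `rank W₁ = 2` and `Ш(W₁)[p] = 0`, hence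
`Ш(W₁)[p^∞] = 0`, `corank_p Ш(W₁) = 0`, `corank Sel_{p^∞}(W₁) = rank + 0 = 2`, and `r_an(W₁) ≥ 2` by the
Gross–Zagier–Kolyvagin contrapositive.
[cite: SilvermanAEC2009, Thm X.4.2] [cite: Darmon2004, Thm. 3.22] [cite: Wuthrich2014, Prop. 21 (p. 400)] -/
theorem squeeze
    (hWu : Wuthrich2014_shaOrder_dvd_of_L_one_ne_zero)
    (hGZK : rank_eq_analyticRank_of_analyticRank_le_one)
    (hmod : ModularForms.existsUnique_isNewformOf)
    (p : ℕ) [hp : Fact p.Prime] (h5 : 5 ≤ p)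
    (W₁ W₂ : WeierstrassCurve ℚ) [W₁.IsElliptic] [W₁.IsGloballyMinimal] [W₂.IsElliptic] [W₂.IsGloballyMinimal]
    (hSel : Nat.card (W₁.selmerGroup (p : ℤ)) = Nat.card (W₂.selmerGroup (p : ℤ)))
    (hr : 2 ≤ W₁.mordellWeilRank) (hL : W₂.entireLFunction 1 ≠ 0) (hgood : W₂.HasGoodReductionAtPrime p)
    (hsurj : W₂.HasSurjectiveModNGaloisRep p) (hnotors : ∀ P : W₂.toAffine.Point, (p : ℤ) • P = 0 → P = 0)
    {q : ℚ} (hq : W₂.entireLFunction 1 / (W₂.realPeriodRat : ℂ) = (q : ℂ))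
    (hv : padicValRat p (q * (W₂.torsionOrder : ℚ) ^ 2 / (W₂.tamagawaProduct : ℚ)) ≤ 2) :
    W₁.mordellWeilRank = 2 ∧ (∀ c ∈ W₁.sha, (p : ℤ) • c = 0 → c = 0) ∧ W₁.shaCorank p = 0 ∧
      W₁.selmerCorank p = 2 ∧ 2 ≤ W₁.analyticRank := by
  have hp0 : p ≠ 0 := hp.out.ne_zero
  have hle : Nat.card (W₁.selmerGroup (p : ℤ)) ≤ p ^ 2 := hSel ▸
    natCard_selmerGroup_le_sq_of_L_one_ne_zero hWu hGZK hmod W₂ p h5 hL hgood hsurj hnotors hq hv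
  -- the descent count for `W₁`: `p^r · t · s ≤ p²` with `t, s ≥ 1`, `r ≥ 2`
  have hSel1 := W₁.natCard_selmerGroup_eq hp0
  obtain ⟨kt, hkt⟩ := exists_natCard_torsionBy_eq_pow W₁ p
  haveI : Finite ((W₁.sha)[(p : ℤ)]) := W₁.finite_sha_torsionBy_holds (p : ℤ) (Int.natCast_ne_zero.mpr hp0)
  obtain ⟨ks, hks⟩ := exists_natCard_eq_pow_of_nsmul_eq_zero (G := (W₁.sha)[(p : ℤ)]) p fun x ↦
    AddSubgroup.torsionBy.nsmul x
  rw [Literature.Algebra.Module.natCard_torsionBy_addSubgroup W₁.sha (p : ℤ)] at hks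
  rw [hkt, hks] at hSel1
  have h1 : p ^ W₁.mordellWeilRank * p ^ kt * p ^ ks ≤ p ^ 2 := hSel1 ▸ hle
  rw [← pow_add, ← pow_add] at h1
  have h2 : W₁.mordellWeilRank + kt + ks ≤ 2 := (Nat.pow_le_pow_iff_right hp.out.one_lt).mp h1
  have hrank : W₁.mordellWeilRank = 2 := by omega
  have hks0 : ks = 0 := by omega
  rw [hks0, pow_zero] at hks
  -- `Ш(W₁)[p] = 0`
  have hbot : (W₁.sha ⊓ AddSubgroup.torsionBy W₁.galH1 (p : ℤ) : AddSubgroup W₁.galH1) = ⊥ :=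
    AddSubgroup.card_eq_one.mp hks
  have hsha : ∀ c ∈ W₁.sha, (p : ℤ) • c = 0 → c = 0 := by
    intro c hc hpc
    have hmem : c ∈ (W₁.sha ⊓ AddSubgroup.torsionBy W₁.galH1 (p : ℤ) : AddSubgroup W₁.galH1) :=
      AddSubgroup.mem_inf.mpr ⟨hc, AddSubgroup.torsionBy.nsmul_iff.mpr (by rwa [natCast_zsmul] at hpc)⟩
    rw [hbot] at hmem
    exact (AddSubgroup.mem_bot).mp hmem
  -- `Ш(W₁)[p^∞] = 0`, so `corank_p Ш(W₁) = 0`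
  have hprim : AddCommGroup.primaryComponent W₁.sha p = ⊥ :=
    CompanionSqueeze.primaryComponent_eq_bot_of_forall_smul_eq_zero p fun a ha ↦
      Subtype.ext (hsha a a.2 (by rw [← AddSubgroupClass.coe_zsmul, ha, ZeroMemClass.coe_zero]))
  have hfinprim : Finite (AddCommGroup.primaryComponent W₁.sha p) := by
    rw [hprim]; infer_instance
  have hco : W₁.shaCorank p = 0 := Literature.BSD.shaCorank_eq_zero_of_finite W₁ p hfinprim
  have hselco : W₁.selmerCorank p = 2 := by
    rw [W₁.selmerCorank_eq_mordellWeilRank_add_holds p, hrank, hco]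
  refine ⟨hrank, hsha, hco, hselco, ?_⟩
  -- `r_an(W₁) ≥ 2` by the GZK contrapositive
  by_contra han
  have h := (hGZK W₁ (by omega)).1
  omega

end CompanionSqueeze

/-- **The support item `CompanionSqueezeKernel` of route `CompanionSqueezeDoorRankTwo` holds**
(stmt-BirchSwinnertonDyer-23777): from the print pack `PublishedInputsCompanion` (Wuthrich 2014
Prop. 21; Gross–Zagier–Kolyvagin; modularity), for `p ≥ 5` and every squeeze pair `(W₁, W₂)`,
`rank W₁ = 2`, `Ш(W₁)[p] = 0`, `corank_p Ш(W₁) = 0`, `corank Sel_{p^∞}(W₁) = 2` and `r_an(W₁) ≥ 2`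
(`CompanionSqueeze.squeeze`). [cite: Wuthrich2014, Prop. 21 (p. 400)] [cite: Darmon2004, Thm. 3.22]
[cite: SilvermanAEC2009, Thm X.4.2] -/
theorem companionSqueezeKernel_proof :
    Summit.BirchSwinnertonDyer.BirchSwinnertonDyer.Theses.CompanionSqueezeDoorRankTwo.CompanionSqueezeKernel := by
  unfold Summit.BirchSwinnertonDyer.BirchSwinnertonDyer.Theses.CompanionSqueezeDoorRankTwo.CompanionSqueezeKernel
    Summit.BirchSwinnertonDyer.BirchSwinnertonDyer.Theses.CompanionSqueezeDoorRankTwo.PublishedInputsCompanion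
  rintro ⟨hWu, hGZK, hmod⟩ p _ h5 W₁ W₂ _ _ _ _ ⟨hSel, hr, hL, hgood, hsurj, hnotors, q, hq, hv⟩
  exact CompanionSqueeze.squeeze hWu hGZK hmod p h5 W₁ W₂ hSel hr hL hgood hsurj hnotors hq hv

end Summit.BirchSwinnertonDyer.BirchSwinnertonDyer.Theorems

end
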